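import Mathlib
import HarnessLib
import HarnessLib.Audit
import Summits.RiemannHypothesis.Statement
import Literature.NumberTheory.LFunctions.LaplaceSeriesAbelian
import HarnessLib.Audit.Status.Attr

/-!
Route: OneSidedGoldbach

DORMANT since 2026-08-22T19:50:39Z (reconciler: no traction for 5.6 d (last activity item-evidence-added at 2026-08-17T04:33:43Z); parked, not closed — `ledger route dormant route-RiemannHypothesis-OneSidedGoldbach --off` to reactivate) — unstaffed, not closed; items shared with open routes are served there. `ledger route dormant <id> --off` reactivates.

Thesis X (words): ONE-SIDED AVERAGE GOLDBACH. For every ε > 0 there is a constant C with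
  S_Λ(n) := Σ_{m ≤ n} Σ_{i+j=m} Λ(i)Λ(j) ≤ n²/2 + C·(n+1)^{3/2+ε}   for all n ∈ ℕ
— the UPPER half alone of the Fujii–Granville asymptotic for the average number of Goldbach
representations (idea card one-sided-goldbach-average). It suffices to show X: because Λ ≥ 0, the
Laplace series F(t) = Σ Λ(n)e^{−nt} is ≥ 0, so the exact identity F(t)² = (1 − e^{−t}) Σ_n S_Λ(n)
e^{−nt} (tree: Literature.NumberTheory.LFunctions.laplaceSeries_sq) turns the ONE-sided bound on S_Λ
into the one-sided Abelian bound F(t) − 1/t ≤ C′ t^{−1/2−ε} on (0,1] by a REAL square root (F =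
√(F²) ≤ √bound); then Landau's lemma for Mellin transforms of eventually non-negative functions
(tree: Literature.NumberTheory.LFunctions.Landau.integrableOn_of_differentiableOn_union_convex, MV
Lemma 15.1), applied to g(x) = (C′+1)x^{1/2+ε} − Σ_n (Λ(n) − 1)e^{−n/x} ≥ 0 (x ≥ 1), whose transform
∫_1^∞ g(x)x^{−s−1}dx = (C′+1)/(s − 1/2 − ε) + Γ(s)(ζ′/ζ(s) + ζ(s)) + (entire) (tree:
mellin_laplaceSeries_vonMangoldt_sub_zeta, exists_abs_laplaceSeries_le_exp_neg) is holomorphic on a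
neighbourhood of the real ray s > 1/2 + ε (ζ(σ) < 0 on (0,1): riemannZeta_neg_of_pos_of_lt_one;
exists_zetaZeroFree_rect; the poles of Γζ′/ζ and Γζ at s = 1 cancel), forces absolute convergence on
Re s > 1/2 + ε, hence ζ′Γ = (holomorphic)·ζ there and no zero of ζ in 1/2 + ε < Re s < 1 (order
comparison, as in quasiRiemannHypothesis_of_laplaceSeries_vonMangoldt_isBigO); all ε give
QuasiRiemannHypothesis (1/2), i.e. RH (quasiRiemannHypothesis_one_half_iff_holds). Conversely RH ⇒ X
two-sidedly (in-tree Granville machinery via von Koch), so X ⇔ RH ⇔ the lower face ⇔ the Laplace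
hub.

X (Lean, elaborated in Sketch.lean against Mathlib +
Literature.NumberTheory.LFunctions.LaplaceSeriesAbelian):
∀ ε : ℝ, 0 < ε → ∃ C : ℝ, ∀ n : ℕ, Literature.NumberTheory.LFunctions.selfConvSum (fun k ↦
(ArithmeticFunction.vonMangoldt k : ℝ)) n - (n : ℝ) ^ 2 / 2 ≤ C * ((n : ℝ) + 1) ^ (3 / 2 + ε)
Assembly: GoldbachUpperFace → Summit.RiemannHypothesis (the new one-sided criterion; provable now
from PROVED cone facts only).

Rationale: WHY THIS LINE. Area imported: additive prime number theory (averages of Goldbach representations: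
Fujii 1991; Granville2007 Thm 1A; BhowmikSchlagepuchta2010; LanguascoZaccagnini2012;
BhowmikRuzsa2018 Thm 2.1; BhowmikHalupczokMatsumotoSuzuki2019 Thm 1(2); BillingtonEtAl2024 Thms 1–3;
MossinghoffTrudgian2022) joined to Landau's one-signed Mellin method (MontgomeryVaughan2007 §15.1,
Lemma 15.1/Thm 15.2; BatemanDiamond2004 Lemma 11.16 as formalised in MertensOneSided.lean). The tree
already PROVES the two-sided equivalence (Sieve.granville_thm1A_holds;
LFunctions.quasiRiemannHypothesis_of_selfConvSum_vonMangoldt = Bhowmik–Ruzsa at full strength δ′ =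
δ), and every printed converse (Granville §5, BHMS p.19 = Ruzsa's sign-of-the-complex-square-root
trick, B–R Thm 2.1, BCSS Thm 2) assumes a TWO-sided asymptotic. Delta of this route: ONE inequality
suffices, in either direction, because positivity Λ ≥ 0 is spent twice — on a real square root of
F(t)² = (1−e^{−t})ΣS_Λ(n)e^{−nt} and on Landau's lemma — instead of on fixing the sign of a complex
square root. Every non-crux item is dischargeable NOW from proved cone facts (LaplaceSeriesAbelian,
VonMangoldtLaplace, LandauOscillation, MertensOneSided, ZetaRealAxis, GeneralizedRH,
GranvilleGoldbachSummatory/Proofs); no named fact, no new definition. Honest limitation (as for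
route Robin): each crux is RH-EQUIVALENT — the main term n²/2 is unconditional (PNT), all content is
the exponent 3/2 — so this is a cheap criterion line whose deliverables are (i) the new one-sided
criterion as sorry-free theorems, (ii) three standing one-sided RH-equivalent targets for
majorant/positivity technology (upper-bound sieves, discarded minor arcs and Parseval-type
expansions are one-sided by nature); it is not a main line and claims no leverage on X itself.
RANKED CRUXES. #2 GoldbachUpperFace = X (RH ⇒ X: Calibration; at ε = 0 true under RH with any C >
4·0.023059 for large n by MossinghoffTrudgian2022 (1.7) + LanguascoZaccagnini2012 O(n log³n); X ⇒
RH: Assembly). #3 LaplaceUpperHub: ∀ε ∃C ∀t∈(0,1], ΣΛ(n)e^{−nt} − 1/t ≤ C t^{−1/2−ε} — the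
prime-only hub every one-sided quadratic statistic of primes passes through (also the natural dedup
anchor for the sibling card one-sided-von-koch-second-moment); RH ⇒ hub by ΣΛ(n)e^{−n/N} = N − Σ_ρ
Γ(ρ)N^ρ + O(1) (BillingtonEtAl2024 §4 (PsiExplicit); GoldstonSuriajaya arXiv:2306.04807 Thm 1) or
in-tree from Calibration + exists_abs_laplaceSeries_sub_inv_le; hub ⇒ RH = LandauStepUpper. #4
GoldbachLowerFace (mirror; LowerFaceToRH). Supports: AbelStepUpper (X → hub, elementary),
LandauStepUpper (hub → RH, the analytic core), LowerFaceToRH, Calibration (RH → two-sided X, in-tree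
via vonKoch_chebyshevPsi_of_riemannHypothesis_holds + abs_goldbachLogSum_sub_le +
exists_abs_selfConvSum_vonMangoldt_sub_goldbachLogSum_le).
KILL CRITERIA. (a) A refuter exhibits a gap in the one-sided Landau step as typed (endpoint s = 1/2
+ ε, the removable point s = 1, or the t ≤ 1 normalisation) that no restatement repairs → close
refuted:LandauStepUpper. (b) The one-sided remark is found in print (Granville2007 §§2,5 is
paywalled, acq-00738; BhowmikRuzsa2018, BHMS2019 pp.3–4,19, BillingtonEtAl2024 pp.3–4,11,
arXiv:2306.04807 p.3, MossinghoffTrudgian2022 pp.296–298 were read and do not contain it) → novelty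
regraded known, route kept for the Lean face only. (c) After Assembly + the four supports land, the
route has delivered its theorem content; it then idles on three RH-equivalent faces → dormant, and
`exhausted` only if a tenure pass finds no additive technology engaging X beyond PNT-strength.
NOT DECOMPOSED YET. No ε = 0 faces (RH ⇒ S_Λ(n) ≤ n²/2 + C n^{3/2} needs the Fujii/BS-P/L–Z explicit
formula S_Λ(x) = x²/2 − 2Σ_ρ x^{ρ+1}/(ρ(ρ+1)) + O(x log³x) as a named fact; file as calibration
later if wanted). No progression/GRH faces (Granville 1B/1C, BHMS Thms 1–4, arXiv:2405.04315). No
short-interval or Cesàro-weighted faces (LanguascoZaccagnini2012, doi:10.1090/proc/13645). No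
negative side: ¬X is ∀C ∃n, not a finite search, and zero-finding dominates it. No lower Laplace hub
as an item (it rides inside LowerFaceToRH with --supports lemmas).
CHEAPEST FALSIFIER. Of the LINE's novelty claim: one read of Granville2007 §5 (paywalled, acq-00738)
or of any printed converse — finding "either half of the average-Goldbach asymptotic already implies
RH" in print regrades the route known (kill (b)); five independent page-level audits
(BhowmikRuzsa2018 = arXiv:1711.06442 in full, arXiv:0806.3295, arXiv:1809.06920 §2.4–2.5/§4,
arXiv:2306.09102 pp.3–6/11, MossinghoffTrudgian2022 pp.296–298, MontgomeryVaughan2007 §15.1) have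
not found it. Of the DECIDING CHAIN: a refuter re-derivation of LandauStepUpper at its three
delicate points (s = 1 removable because the residues −1 of Γζ′/ζ and +1 of Γζ cancel; the abscissa
a = 1/2 + ε handled by running Landau at ε/2; ε ≥ 1/2 reduced to ε′ < 1/2) — done four times
(REVIEW-gen1 … gen3 evidence), no gap. Of the FACES: nothing cheap exists — each is RH-equivalent
and ∃C-shaped, so no finite computation refutes one; the only numerical sanity check is that (S_Λ(n)
− n²/2)/n^{3/2} stays inside ±4·0.023059 + o(1) (MossinghoffTrudgian2022 (1.7)), and an excursion at
accessible n would contradict RH itself.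
SUPPORT. Import hygiene (route-repair 2026-08-15): the route file imports ONLY
Literature.NumberTheory.LFunctions.LaplaceSeriesAbelian (selfConvSum, laplaceSeries,
laplaceSeries_sq — the one Literature module the eight statements mention), so the route's cone
carries no unproved named fact; needs-fact: NONE — the ten open defs/XL facts of RHWave0.lean and
GeneralizedRH.lean (LindelofHypothesis, GeneralizedRiemannHypothesis, RiemannHypothesisStrip,
SimpleZerosConjecture, NoSiegelZeros, platt_trudgian_numerical_rh, bourgain_subconvexity, the two
zero-free regions, deuring_heilbronn) rode in on `import VonMangoldtLaplace` (→ VonKochConverse →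
VonKochEquivalence → RHClassicalEquivalents → RHWave0) and `import GeneralizedRH` and are used by no
item. Provers import what their proofs use in their own Theorems files, all PROVED:
VonMangoldtLaplace (mellin_laplaceSeries_vonMangoldt_sub_zeta, exists_abs_laplaceSeries_le_exp_neg,
abs_laplaceSeries_zeta_sub_inv_le, quasiRiemannHypothesis_of_laplaceSeries_vonMangoldt_isBigO as the
two-sided template), LandauOscillation (Landau.integrableOn_of_differentiableOn_union_convex,
differentiableOn_mellinIoi), ZetaRealAxis (riemannZeta_neg_of_pos_of_lt_one), MertensOneSided
(exists_zetaZeroFree_rect; one-signed Landau use) and PsiOscillationFromZero (MV Thm 15.3 pattern,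
the refuters' recommended template for 1125/1126), GeneralizedRH
(quasiRiemannHypothesis_one_half_iff_holds), VonKochTheorem +
Sieve.GranvilleGoldbachSummatory/GranvilleGoldbachProofs (Calibration). Deciding theorem: closes :
GoldbachUpperFace → AbelStepUpper → LandauStepUpper → Summit.RiemannHypothesis (= LandauStepUpper ∘
AbelStepUpper, the Assembly item factored through the hub); AbelStepUpper (1124) and the Abelian
half of LowerFaceToRH (1126) have sorry-free candidates attached as item evidence (REVIEW-gen3), so
the live theorem debt is LandauStepUpper (1125), its sign twin inside 1126, Calibration (1127), and
the crux X itself.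

Novelty: Nearest prior art (searched 2026-08-15: zbMATH "Goldbach average Riemann hypothesis" (18 rows:
BhowmikRuzsa2018 = arXiv:1711.06442, arXiv:1601.06902 Goldston–Yang, arXiv:2306.04807
Goldston–Suriajaya, arXiv:2411.00323, arXiv:2405.04315, …); `lit galaxy search "Goldbach
representations" --star pdf` → arXiv:2306.09102 = BillingtonEtAl2024 (READ pp.3–4, 11: Thms 1–3,
converse via Bhowmik–Ruzsa generalised, two-sided; states BHMS's converse "G(N) = N²/2 +
O(N^{2−c+ε}) ⇒ ζ ≠ 0 on Re s > 1 − c" as best possible) and MossinghoffTrudgian2022 =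
doi:10.5802/jtnb.1202 (READ pp.296–298: under RH S_Λ(x) = x²/2 − 4x^{3/2}G(x) + O(x log³x), |G(x)| <
0.023059, G(x) < −0.022978 and > 0.021030 infinitely often); BhowmikHalupczokMatsumotoSuzuki2019 =
arXiv:1704.06103 (READ pp.3–4 Thm 1(2), p.19: positivity of the coefficients is used only to fix the
sign of the COMPLEX square root of F(z)² on the major arc, hypothesis two-sided); Granville2007 Thm
1A (in tree as Sieve.granville_thm1A, PROVED both ways); MontgomeryVaughan2007 §15.1 (READ
p.358–359: Lemma 15.1, Ex. 15.1.2 ψ₁(x) − x²/2 = Ω±(x^{3/2}), Ex. 15.1.4(c) Σμ(n)e^{−n/x} =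
Ω±(x^{1/2}) — the e^{−n/x}-smoothed one-signed Landau method, for μ); the refuter novelty audit of
the card (2026-08-15, grade new-combination) read BhowmikRuzsa2018 in full. OpenAlex/S2 legs were
rate-limited (HTTP 429) and the local searchd was unavailable (rc 75) during this pass. Delta: all
printed converses (Granville §5; BhowmikSchlagepuchta2010; BHMS Thm 1(2); Bhow  [refs: 10.5802/jtnb.1202, 1711.06442, 1601.06902, 2306.04807, 2411.00323, 2405.04315, 2306.09102, 1704.06103, doi:10.5802/jtnb.1202, BhowmikRuzsa2018, BillingtonEtAl2024, MossinghoffTrudgian2022, BhowmikHalupczokMatsumotoSuzuki2019, Granville2007, MontgomeryVaughan2007, BhowmikSchlagepuchta2010]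

Barriers (technique_class: one-signed-error-term Goldbach-average Landau-method): technique_class: one-signed-error-term Goldbach-average Landau-method
Literature.Barriers.RiemannHypothesis.LittlewoodOscillation — class met (one-signed error terms
closed by Landau–Mellin converses) but not hit: the barrier kills SHARPER-than-RH or
eventually-one-SIGNED prime-counting claims (ψ(x) − x = O(√x); π < li); every face here sits at the
RH scale with RH-supplied constants — S_Λ(n) − n²/2 ≤ C(n+1)^{3/2+ε} (two-sided true under RH:
in-tree Calibration; at ε = 0, |S_Λ(x) − x²/2| ≤ 4·0.023059·x^{3/2} + O(x log³x),
MossinghoffTrudgian2022 (1.7)) and ΣΛ(n)e^{−nt} − 1/t ≤ C t^{−1/2−ε} (RH: = −Σ_ρ Γ(ρ)t^{−ρ} + O(1),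
Σ|Γ(ρ)| < ∞) — never S_Λ(n) ≤ n²/2 or an o(x^{3/2}) claim (false: MossinghoffTrudgian2022 (1.6)
gives both signs at scale x^{3/2}; MV Ex. 15.1.2). The unsmoothed sharp-cutoff analogue of the hub,
ψ(x) ≤ x + C√x, IS killed by this barrier (MV Thm 15.11); the heat weight e^{−nt} damps each zero by
|Γ(ρ)| ≍ e^{−π|γ|/2}, which is why the hub is RH-implied. The barrier's engine (MV Lemma 15.1, in
tree) is the route's closing tool, used as a converse exactly as in von Koch's and Robin's
equivalences.
Literature.Barriers.RiemannHypothesis.DiamondMontgomeryVorhauer2006_thm1 — class met (Landau-method)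
and NOT evaded as a route to proving X: the bridge X → RH is multiplicative/analytic and would run
verbatim for a Beurling system, so any eventual proof of a face must import structure of ℤ beyond
N(x) = x + O(x^θ), θ > 1/2; the only such structure on offer is that X is

Novelty grade: new-combination — ROUTE REVIEW gen-1 (refuter 65db103a, 2026-08-15; full text = evidence REVIEW-gen1.md on this route). VERDICT: sound CRITERION route; keep open for theorem items 1124–1128, then supersede. Completes refuter 8337d40c's item review (8/8 stamped; kill (a) no gap — re-derived here: W₀ open thin zero-fre (refuter refuter-rreview-route-HubbardSuperconduc-65db103a-0, 2026-08-15T12:10:16Z; prior: arXiv:1711.06442 (BhowmikRuzsa2018 Thm 2.1 + Rem. 1: two-sided, complex square root; READ in full), arXiv:0806.3295 (BhowmikSchlagePuchta2010 Thm 1.1: Omega(x loglog x) via jumps of G(n); READ pp.2-4), arXiv:1809.06920 (Bhowmik-Halupczok survey 2020 sec.2.4-2.5, sec.4: printed converse architecture, two-sided; READ), arXiv:2306.09102 (BillingtonEtAl2024 Lemma 1/p.5 cross-term obstruction, Omega+-()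

History (route lifecycle, newest last):
- 2026-08-22T19:50:39Z · DORMANT — reconciler: no traction for 5.6 d (last activity item-evidence-added at 2026-08-17T04:33:43Z); parked, not closed — `ledger route dormant route-RiemannHypothesi (operator:999:394024)

sub-problem: RiemannHypothesis · status: dormant · opened planner-plancard-RiemannHypothesis-RiemannHyp-6728076c-0 2026-08-15T10:51:32Z · rev 2 · ledger route-RiemannHypothesis-OneSidedGoldbach
GENERATED by the gate from the ledger (D-0016/17). Provers cite these decls: `theorem foo : Summit.RiemannHypothesis.RiemannHypothesis.Theses.OneSidedGoldbach.<Decl> := …` in Summits/RiemannHypothesis/RiemannHypothesis/Theorems/<Name>.lean.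
-/

namespace Summit.RiemannHypothesis.RiemannHypothesis.Theses.OneSidedGoldbach

open scoped BigOperators Topology Manifold Classical MeasureTheory ProbabilityTheory Matrix InnerProductSpace ComplexConjugate ContinuousMap
open Filter Set Function TopologicalSpace MeasureTheory

attribute [summit_statement] _root_.Summit.RiemannHypothesis

open Summit

/-- item stmt-RiemannHypothesis-1121 · crux · rank 2 · open · by planner
why it might fail: Open, RH-equivalent: false iff RH false. A zero with Re ρ₀=β₀>1/2 gives S_Λ(x)−x²/2=Ω₊(x^{1+β₀−δ}) (Landau's lemma on F(t)²=(1−e^{−t})ΣS_Λ(n)e^{−nt}, MV Thm 15.2 pattern), so X fails for ε<β₀−1/2. The ε=0 variant needs C>4·0.022978 even on RH (MossinghoffTrudgian2022 Thm 1.1 (1.6)).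
sources: Granville2007, BhowmikRuzsa2018, BhowmikSchlagepuchta2010, LanguascoZaccagnini2012, MossinghoffTrudgian2022, MontgomeryVaughan2007
[crux] Thesis X = the UPPER half alone of the Fujii–Granville average-Goldbach asymptotic: for every
ε > 0, S_Λ(n) = Σ_{m≤n}Σ_{i+j=m}Λ(i)Λ(j) ≤ n²/2 + C_ε (n+1)^{3/2+ε} for all n (tree notation
selfConvSum, LaplaceSeriesAbelian.lean; (n+1)^α as in
quasiRiemannHypothesis_of_selfConvSum_vonMangoldt). RH-EQUIVALENT: RH ⇒ X two-sidedly (Calibration,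
in-tree via von Koch; at ε = 0 under RH S_Λ(x) − x²/2 = −4x^{3/2}G(x) + O(x log³x), |G| < 0.023059,
MossinghoffTrudgian2022 (1.3),(1.7), LanguascoZaccagnini2012); X ⇒ RH is the Assembly (new:
one-sided). The additive-side standing target of the route; honest: the main term n²/2 is
unconditional by PNT (S_Λ(N) = Σ_{a≤N}Λ(a)ψ(N−a)), all content is the exponent. Why it might fail:
false iff RH false; at ε = 0 it needs C > 4·0.022978 (MossinghoffTrudgian2022 (1.6)). Sources:
Granville2007 Thm 1A; BhowmikSchlagepuchta2010; LanguascoZaccagnini2012; MossinghoffTrudgian2022;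
BhowmikRuzsa2018 Thm 2.1; Literature.NumberTheory.Sieve.granville_thm1A_holds. -/
@[route_item "route-RiemannHypothesis-OneSidedGoldbach", crux]
def GoldbachUpperFace : Prop :=
  ∀ ε : ℝ, 0 < ε → ∃ C : ℝ, ∀ n : ℕ, Literature.NumberTheory.LFunctions.selfConvSum (fun k ↦ (ArithmeticFunction.vonMangoldt k : ℝ)) n - (n : ℝ) ^ 2 / 2 ≤ C * ((n : ℝ) + 1) ^ (3 / 2 + ε)

/-- item stmt-RiemannHypothesis-1122 · crux · rank 3 · open · by planner
why it might fail: Open, RH-equivalent: false iff RH false. RH ⇒ F(1/N)²=Σψ₂(n)e^{−n/N}=N²−2Σ_ρΓ(ρ)N^{ρ+1}+O(N) (arXiv:2306.04807 Thm 1); a zero with β₀>1/2 forces ΣΛ(n)e^{−nt}−1/t=Ω±(t^{−β₀+δ}) by Landau (MV Lemma 15.1). Smoothing is load-bearing: sharp ψ(x)≤x+C√x is FALSE (Littlewood; MV Thm 15.11).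
sources: MontgomeryVaughan2007, arXiv:2306.04807, BillingtonEtAl2024, Littlewood1914, Literature.Barriers.RiemannHypothesis.LittlewoodOscillation, Literature.NumberTheory.LFunctions.quasiRiemannHypothesis_of_laplaceSeries_vonMangoldt_isBigO
[crux] The one-sided Laplace–von Koch hub: for every ε > 0, Σ_n Λ(n)e^{−nt} − 1/t ≤ C_ε t^{−1/2−ε}
for 0 < t ≤ 1 (tree: laplaceSeries). Prime-only statement through which every one-sided QUADRATIC
statistic of primes passes (here via F(t)² = (1−e^{−t})ΣS_Λ(n)e^{−nt} and F ≥ 0; the sibling card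
one-sided-von-koch-second-moment would pass through the same hub — dedup anchor). RH-EQUIVALENT: RH
⇒ hub by the explicit formula ΣΛ(n)e^{−n/N} = N − Σ_ρ Γ(ρ)N^ρ + O(1) with Σ_ρ|Γ(ρ)| < ∞
(BillingtonEtAl2024 §4 (PsiExplicit); arXiv:2306.04807 Thm 1), or in-tree from Calibration +
exists_abs_laplaceSeries_sub_inv_le; hub ⇒ RH = LandauStepUpper (one-sided Landau,
MontgomeryVaughan2007 Lemma 15.1 / proof of Thm 15.2). The two-sided O-version is PROVED in tree
(quasiRiemannHypothesis_of_laplaceSeries_vonMangoldt_isBigO). Why it might fail: false iff RH false;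
the smoothing is load-bearing — the sharp-cutoff analogue ψ(x) ≤ x + C√x is FALSE (Littlewood1914;
MV Thm 15.11; barrier LittlewoodOscillation), the weight e^{−nt} damps each zero by |Γ(ρ)| ≍
e^{−π|γ|/2}. Sources: MontgomeryVaughan2007 §15.1 (Lemma 15.1, Thm 15.2, Ex. 15.1.4(c));
BillingtonEtAl2024 §4; arXiv:2306.04807; Littlewood1914. -/
@[route_item "route-RiemannHypothesis-OneSidedGoldbach"]
def LaplaceUpperHub : Prop :=
  ∀ ε : ℝ, 0 < ε → ∃ C : ℝ, ∀ t : ℝ, 0 < t → t ≤ 1 → Literature.NumberTheory.LFunctions.laplaceSeries (fun k ↦ (ArithmeticFunction.vonMangoldt k : ℝ)) t - 1 / t ≤ C * t ^ (-(1 / 2 + ε))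

/-- item stmt-RiemannHypothesis-1123 · crux · rank 4 · open · by planner
why it might fail: Mirror face, RH-equivalent: false iff RH false. A zero β₀>1/2 gives S_Λ(x)−x²/2=Ω₋(x^{1+β₀−δ}) (sign-flipped Landau identity, MV Thm 15.2 proof): fails for ε<β₀−1/2. No majorant/minor-arc device yields LOWER bounds for prime-pair sums. ε=0 needs C>4·0.021030 on RH (MossinghoffTrudgian2022 (1.6)).
sources: Granville2007, MossinghoffTrudgian2022, BhowmikRuzsa2018, LanguascoZaccagnini2012, MontgomeryVaughan2007, Literature.NumberTheory.Sieve.granville_thm1A_holds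
[crux] The LOWER half alone: for every ε > 0, n²/2 − S_Λ(n) ≤ C_ε (n+1)^{3/2+ε} for all n.
RH-EQUIVALENT (RH ⇒ it: Calibration; it ⇒ RH: LowerFaceToRH, the sign-flipped chain F(t)² ≥ t^{−2}(1
− K t^{1/2−ε}) ⇒ F(t) − 1/t ≥ −K t^{−1/2−ε} ⇒ Landau on Σ(Λ(n)−1)e^{−n/x} + (K+1)x^{1/2+ε} ≥ 0).
Filed as its own crux because 'either half of Granville's equivalence suffices' is the route's claim
and because lower bounds for prime-pair averages have a different (poorer) technology profile: no
majorant/minor-arc-discarding mechanism produces them. Why it might fail: false iff RH false; at ε =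
0 it needs C > 4·0.021030 (MossinghoffTrudgian2022 (1.6): G(x) > 0.021030 infinitely often under
RH). Sources: Granville2007 Thm 1A; MossinghoffTrudgian2022; BhowmikRuzsa2018; Fujii (Comment. Math.
Univ. St. Pauli 40 (1991)) as cited in MossinghoffTrudgian2022 (1.3). -/
@[route_item "route-RiemannHypothesis-OneSidedGoldbach"]
def GoldbachLowerFace : Prop :=
  ∀ ε : ℝ, 0 < ε → ∃ C : ℝ, ∀ n : ℕ, (n : ℝ) ^ 2 / 2 - Literature.NumberTheory.LFunctions.selfConvSum (fun k ↦ (ArithmeticFunction.vonMangoldt k : ℝ)) n ≤ C * ((n : ℝ) + 1) ^ (3 / 2 + ε)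

/-- item stmt-RiemannHypothesis-1124 · support · rank 9 · open · by planner
sources: BhowmikRuzsa2018, Literature.NumberTheory.LFunctions.exists_abs_laplaceSeries_sub_inv_le
[support] One-sided Abelian step (elementary real analysis; the one-sided variant of the tree's
exists_abs_laplaceSeries_sub_inv_le, LaplaceSeriesAbelian.lean): from S_Λ(n) − n²/2 ≤ C(n+1)^α (α =
3/2 + ε < 2; for ε ≥ 1/2 use the hypothesis at a smaller ε) and laplaceSeries_sq, F(t)² =
(1−e^{−t})ΣS_Λ(n)e^{−nt} ≤ (1−e^{−t})[Σ(n²/2)e^{−nt} + CΣ(n+1)^α e^{−nt}] ≤ t^{−2}(1 + 3t) +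
C·K_α·t^{−α} ≤ t^{−2}(1 + K′t^{2−α}) (using t^{−1} ≤ t^{−α} for t ≤ 1, α > 1) on 0 < t ≤ 1 (tree:
tsum_pow_succ_rpow_mul_exp_le, one_sub_exp_neg_bounds); F ≥ 0 (laplaceSeries_nonneg) gives F(t) =
√(F²) ≤ t^{−1}(1 + K′t^{2−α}/2) = 1/t + (K′/2)t^{1−α}. Sources: BhowmikRuzsa2018 proof of Thm 2.1
(power-series step); tree LaplaceSeriesAbelian.lean. -/
@[route_item "route-RiemannHypothesis-OneSidedGoldbach", crux]
def AbelStepUpper : Prop :=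
  GoldbachUpperFace → LaplaceUpperHub

/-- item stmt-RiemannHypothesis-1125 · support · rank 9 · open · by planner
sources: MontgomeryVaughan2007, BatemanDiamond2004, Literature.NumberTheory.LFunctions.Landau.integrableOn_of_differentiableOn_union_convex
[support] One-sided Landau step — the analytic core of the new criterion, all inputs PROVED in tree.
Fix ε ∈ (0,1/2), C from the hub; b = Λ − ζ̂ (arith.), f = laplaceSeries b, so f(t) ≤ (C+1)t^{−1/2−ε}
on (0,1] (abs_laplaceSeries_zeta_sub_inv_le). Put g(x) := (C+1)x^{1/2+ε} − f(1/x) ≥ 0 for x ≥ 1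
(measurable; |f(1/x)| = O(x log x)). For Re s > 2: Landau.mellinIoi g s = (C+1)/(s − 1/2 − ε) −
∫_0^1 f(t)t^{s−1}dt = (C+1)/(s−1/2−ε) − Γ(s)(−ζ′/ζ(s) − ζ(s)) + E(s), E(s) = ∫_1^∞ f(t)t^{s−1}dt
entire (mellin_laplaceSeries_vonMangoldt_sub_zeta; exists_abs_laplaceSeries_le_exp_neg; substitution
x = 1/t as in MertensOneSided.integral_Ioi_eq_integral_exp style). The right side is holomorphic on
{Re s > 1} ∪ W₀, W₀ a thin open rectangle about the real segment (1/2 + ε, 3]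
(exists_zetaZeroFree_rect / riemannZeta_neg_of_pos_of_lt_one; at s = 1 write (s−1)ζ(s) = B(s), ζ′/ζ
+ ζ = B′/B + dslope B 1, removable). Landau.integrableOn_of_differentiableOn_union_convex (a = 1/2 +
ε) ⇒ ∫_1^∞|g|x^{−σ−1} < ∞ for σ > 1/2 + ε ⇒ mellinIoi g holomorphic on Re s > 1/2 + ε
(differentiableOn_mellinIoi) ⇒ ζ′Γ = H·ζ there with H holomorphic ⇒ a zero of ζ in 1/2 + ε < Re s <
1 is impossible (order comparison, exactly -/
@[route_item "route-RiemannHypothesis-OneSidedGoldbach", crux]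
def LandauStepUpper : Prop :=
  LaplaceUpperHub → Summit.RiemannHypothesis

/-- item stmt-RiemannHypothesis-1126 · support · rank 9 · open · by planner
sources: MontgomeryVaughan2007, BhowmikRuzsa2018
[support] The lower face also gives RH (sign-flipped chain). Abelian step: (1−e^{−t})Σ(n²/2)e^{−nt}
≥ t^{−2}(1 − 3t/2), so F(t)² ≥ t^{−2}(1 − K t^{2−α}) and, since F ≥ 0 and √(1−u) ≥ 1 − u on [0,1]
(trivial when u > 1), F(t) − 1/t ≥ −K t^{1−α} on (0,1]. Landau step with g(x) := f(1/x) +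
(K+1)x^{1/2+ε} ≥ 0, transform ∫_1^∞ g x^{−s−1} = Γ(s)(−ζ′/ζ(s) − ζ(s)) − E(s) + (K+1)/(s − 1/2 − ε)
on Re s > 2; same continuation and conclusion as LandauStepUpper. Provers may attach a
LaplaceLowerHub lemma with --supports. Sources: as for AbelStepUpper/LandauStepUpper. -/
@[route_item "route-RiemannHypothesis-OneSidedGoldbach"]
def LowerFaceToRH : Prop :=
  GoldbachLowerFace → Summit.RiemannHypothesis

/-- item stmt-RiemannHypothesis-1127 · support · rank 9 · open · by planner
sources: Granville2007, MontgomeryVaughan2007, Literature.NumberTheory.Sieve.granville_thm1A_holds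
[support] Calibration RH ⇒ two-sided X (so X, the lower face and — via
exists_abs_laplaceSeries_sub_inv_le — the hub are all RH-EQUIVALENT once the bridges land). In-tree
chain (all PROVED): RH ⇒ ψ(x) = x + O(√x log²x) (vonKoch_chebyshevPsi_of_riemannHypothesis_holds,
VonKochTheorem.lean) ⇒ |θ(n) − n| ≤ A(n+1)^{1/2+ε} ⇒ goldbachLogSum(x) = x²/2 + O(x^{3/2+ε})
(Sieve.GoldbachAverage: abs_goldbachLogSum_sub_le, GranvilleGoldbachSummatory.lean) ⇒ selfConvSum Λ
= goldbachLogSum + O(x^{3/2}) (exists_abs_selfConvSum_vonMangoldt_sub_goldbachLogSum_le) ⇒ uniform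
(n+1)^{3/2+ε} bound (exists_abs_le_succ_rpow_of_isBigO). This is Granville2007 §5 (5.2) / the ⇒ half
of granville_thm1A_holds restated for S_Λ without the singular-series bookkeeping. At ε = 0 (not
filed) one needs Fujii's explicit formula with error O(x log³x) (BhowmikSchlagepuchta2010;
LanguascoZaccagnini2012). Sources: Granville2007 §5; MontgomeryVaughan2007 Thm 13.1; tree
GranvilleGoldbachProofs.lean. -/
@[route_item "route-RiemannHypothesis-OneSidedGoldbach"]
def Calibration : Prop :=
  Summit.RiemannHypothesis → ∀ ε : ℝ, 0 < ε → ∃ C : ℝ, ∀ n : ℕ, |Literature.NumberTheory.LFunctions.selfConvSum (fun k ↦ (ArithmeticFunction.vonMangoldt k : ℝ)) n - (n : ℝ) ^ 2 / 2| ≤ C * ((n : ℝ) + 1) ^ (3 / 2 + ε)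

/-- item stmt-RiemannHypothesis-1128 · assembly · rank 1 · open · by planner
sources: Granville2007, BhowmikRuzsa2018, MontgomeryVaughan2007
[assembly] X → RH: the new ONE-SIDED average-Goldbach criterion (card one-sided-goldbach-average).
Glue = AbelStepUpper then LandauStepUpper (fun h ↦ landau (abel h)); provable directly as well.
Every input is a PROVED cone fact (LaplaceSeriesAbelian, VonMangoldtLaplace, LandauOscillation,
MertensOneSided, ZetaRealAxis, GeneralizedRH). With Calibration it yields RH ⇔ X ⇔ GoldbachLowerFace
⇔ LaplaceUpperHub, i.e. either half of Granville's Thm 1A equivalence is already RH-equivalent —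
absent from Granville2007/BhowmikRuzsa2018/BHMS2019/BillingtonEtAl2024, whose converses are
two-sided. -/
@[route_item "route-RiemannHypothesis-OneSidedGoldbach"]
def Assembly : Prop :=
  GoldbachUpperFace → Summit.RiemannHypothesis

/-! D-0027 §2.1 — DECIDING THEOREM (planner-authored via `route open/edit --closes-file`; by planner-rbadge-RiemannHypothesis-OneSidedGoldb-4a425f95-g2-0 2026-08-15T16:13:23Z):
its hypotheses are this route's items and its conclusion the sub-problem Statement (glue_lint), and it elaborates with this file. -/

@[closes "route-RiemannHypothesis-OneSidedGoldbach"] theorem closes (hX : GoldbachUpperFace) (hAbel : AbelStepUpper) (hLandau : LandauStepUpper) :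
    _root_.Summit.RiemannHypothesis :=
  hLandau (hAbel hX)

end Summit.RiemannHypothesis.RiemannHypothesis.Theses.OneSidedGoldbach
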